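import Summits.RiemannHypothesis.RiemannHypothesis.Theses.SpectralTrace
import Summits.RiemannHypothesis.RiemannHypothesis.Theorems.SpectralTraceWindowCompactness
import Summits.RiemannHypothesis.RiemannHypothesis.Theorems.SpectralTraceSpectralThesisStubClosedLadder
import Summits.RiemannHypothesis.RiemannHypothesis.Theorems.SpectralTraceSpectralThesisStubBaseRung
import Summits.RiemannHypothesis.RiemannHypothesis.Theorems.SpectralTraceSpectralThesisOpenLadderCalibration
import Literature.NumberTheory.LFunctions.UniformWeilPositivityRH
import HarnessLib

/-!
# SpectralTrace / crux `SpectralThesis` (stmt-RiemannHypothesis-0187), line `Sketch` —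
the BREAKING WINDOW: threshold normal form of the line's residue

Line `Sketch` writes the crux `X = SpectralThesis` (`↔ RH`) as a continuity method on the window
parameter of the OPEN-WINDOW rungs

  `Rung(A) := ∃ (ι : Type) (γ : ι → ℝ), ∀ g, IsWeilTest g → tsupport g ⊆ Ioo (-A) A →
      HasSum (i ↦ ĝ(1/2 + iγ_i)) (W g)`.

BASE (`∃ A₀ > 0, Rung(A₀)`, `stub_baseRung`, p116629) and CLOSED (`stub_closedLadder`, p91348) are
THEOREMS; the one open stub OPEN (`∀ A > 0, Rung(A) → ∃ ε > 0, Rung(A + ε)`) is `↔ RH`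
(`openLadder_iff_riemannHypothesis`). This file records, RH-free, what the two theorems say about
the rung set `{A > 0 | Rung(A)}`: it is a non-empty CLOSED DOWN-SET of `(0, ∞)`, hence EITHER all
of `(0, ∞)` (`↔ RH`) OR a bounded interval `(0, A*]` with a sharp, ATTAINED breaking window
`A* > 0`:

* `Threshold.exists_of_not_forall`, `Threshold.unique`, `Threshold.not_forall`,
  `Threshold.not_open`, `Threshold.forall_or_exists` — the order theory on `(0, ∞)`;
* `exists_breakingWindow_of_not_riemannHypothesis`, `not_riemannHypothesis_of_breakingWindow`,
  **`stub_breakingWindow : ¬ RH ↔ ∃ A* > 0, ∀ A > 0, (Rung(A) ↔ A ≤ A*)`** (registered anchor),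
  `riemannHypothesis_or_exists_breakingWindow`, `breakingWindow_unique`;
* `spectralThesis_iff_rungs_unbounded : X ↔ ∀ B, ∃ A > B, Rung(A)`;
* the positivity side: `weilPositivityOn_of_two_mul_lt_breakingWindow` (Weil positivity holds on
  every `[-a, a]` with `2a < A*`) and `breakingWindow_le_two_mul_of_not_weilPositivityOn`
  (`A* ≤ 2a` whenever `WeilPositivityOn a` fails), `exists_not_weilPositivityOn_of_breakingWindow`.

So a failure of RH is witnessed by ONE positive real `A*`: real unit-atomic spectra reproduce the
Weil distribution on the tests supported in `(-A*, A*)` and on no larger open window.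

References: E. Bombieri, Rend. Lincei (9) 11 (2000) 183–233, Thms. 1–2; H. Yoshida, Adv. Stud.
Pure Math. 21 (1992) (in-tree `riemannHypothesis_iff_forall_weilPositivityOn`).
-/

noncomputable section

set_option linter.dupNamespace false

namespace Summit.RiemannHypothesis.RiemannHypothesis.Theorems.SpectralThesis.Sketch

open Complex Set
open Literature.NumberTheory.LFunctions
open Summit.RiemannHypothesis.RiemannHypothesis.Theses.SpectralTrace
open Summit.RiemannHypothesis.RiemannHypothesis.Theorems

/-! ## Order theory on `(0, ∞)`: a non-empty closed down-set is everything or has a threshold -/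

namespace Threshold

variable {P : ℝ → Prop}

/-- **Threshold of a closed down-set.** A down-closed property of reals which holds at some
positive point, passes to increasing limits, and FAILS at some positive point, holds on the
positive reals EXACTLY up to a positive threshold `A*` (included): `P A ↔ A ≤ A*` for `A > 0`
(`A*` is the supremum of the good set; it is good by closedness). [folklore] -/
theorem exists_of_not_forall (mono : ∀ {x y : ℝ}, x ≤ y → P y → P x)
    (base : ∃ A₀ : ℝ, 0 < A₀ ∧ P A₀)
    (cls : ∀ A : ℝ, 0 < A → (∀ A' : ℝ, 0 < A' → A' < A → P A') → P A)
    (hnot : ¬ ∀ A : ℝ, 0 < A → P A) :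
    ∃ Astar : ℝ, 0 < Astar ∧ ∀ A : ℝ, 0 < A → (P A ↔ A ≤ Astar) := by
  obtain ⟨A₀, hA₀, hP₀⟩ := base
  obtain ⟨A₁, hA₁, hnP₁⟩ : ∃ A₁ : ℝ, 0 < A₁ ∧ ¬ P A₁ := by
    by_contra h
    push Not at h
    exact hnot h
  set S : Set ℝ := {x | 0 < x ∧ P x} with hS
  have hmem₀ : A₀ ∈ S := ⟨hA₀, hP₀⟩
  have hne : S.Nonempty := ⟨A₀, hmem₀⟩
  have hbdd : ∀ x ∈ S, x ≤ A₁ := by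
    intro x hx
    by_contra hxA
    push Not at hxA
    exact hnP₁ (mono hxA.le hx.2)
  have hBdd : BddAbove S := ⟨A₁, hbdd⟩
  have hs_pos : 0 < sSup S := lt_of_lt_of_le hA₀ (le_csSup hBdd hmem₀)
  refine ⟨sSup S, hs_pos, fun A hA => ⟨fun hPA => le_csSup hBdd ⟨hA, hPA⟩, fun hle => ?_⟩⟩
  rcases hle.lt_or_eq with hlt | heq
  · obtain ⟨x, hxS, hAx⟩ := exists_lt_of_lt_csSup hne hlt
    exact mono hAx.le hxS.2
  · rw [heq]
    refine cls _ hs_pos fun A' _ hA'lt => ?_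
    obtain ⟨x, hxS, hA'x⟩ := exists_lt_of_lt_csSup hne hA'lt
    exact mono hA'x.le hxS.2

/-- A threshold is unique. [folklore] -/
theorem unique {a b : ℝ} (ha : 0 < a) (hb : 0 < b)
    (hPa : ∀ A : ℝ, 0 < A → (P A ↔ A ≤ a)) (hPb : ∀ A : ℝ, 0 < A → (P A ↔ A ≤ b)) : a = b :=
  le_antisymm ((hPb a ha).1 ((hPa a ha).2 le_rfl)) ((hPa b hb).1 ((hPb b hb).2 le_rfl))

/-- A threshold means the property fails somewhere (at `A* + 1`). [folklore] -/
theorem not_forall {a : ℝ} (ha : 0 < a) (hPa : ∀ A : ℝ, 0 < A → (P A ↔ A ≤ a)) :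
    ¬ ∀ A : ℝ, 0 < A → P A := fun h => by
  have h1 : a + 1 ≤ a := (hPa (a + 1) (by linarith)).1 (h (a + 1) (by linarith))
  linarith

/-- A threshold means the property is NOT open (it holds at `A*` and at no `A* + ε`). [folklore] -/
theorem not_open {a : ℝ} (ha : 0 < a) (hPa : ∀ A : ℝ, 0 < A → (P A ↔ A ≤ a)) :
    ¬ ∀ A : ℝ, 0 < A → P A → ∃ ε : ℝ, 0 < ε ∧ P (A + ε) := fun hO => by
  obtain ⟨ε, hε, hPε⟩ := hO a ha ((hPa a ha).2 le_rfl)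
  have h1 : a + ε ≤ a := (hPa (a + ε) (by linarith)).1 hPε
  linarith

/-- **Dichotomy.** A non-empty closed down-set of `(0, ∞)` is all of `(0, ∞)` or has a positive
threshold. [folklore] -/
theorem forall_or_exists (mono : ∀ {x y : ℝ}, x ≤ y → P y → P x)
    (base : ∃ A₀ : ℝ, 0 < A₀ ∧ P A₀)
    (cls : ∀ A : ℝ, 0 < A → (∀ A' : ℝ, 0 < A' → A' < A → P A') → P A) :
    (∀ A : ℝ, 0 < A → P A) ∨ ∃ Astar : ℝ, 0 < Astar ∧ ∀ A : ℝ, 0 < A → (P A ↔ A ≤ Astar) := by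
  by_cases h : ∀ A : ℝ, 0 < A → P A
  · exact Or.inl h
  · exact Or.inr (exists_of_not_forall mono base cls h)

/-- With base and closedness given, OPENNESS is equivalent to the property holding everywhere on
`(0, ∞)` (the continuity method one way, `ε = 1` the other). [folklore] -/
theorem open_iff_forall (mono : ∀ {x y : ℝ}, x ≤ y → P y → P x)
    (base : ∃ A₀ : ℝ, 0 < A₀ ∧ P A₀)
    (cls : ∀ A : ℝ, 0 < A → (∀ A' : ℝ, 0 < A' → A' < A → P A') → P A) :
    (∀ A : ℝ, 0 < A → P A → ∃ ε : ℝ, 0 < ε ∧ P (A + ε)) ↔ ∀ A : ℝ, 0 < A → P A :=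
  ⟨fun opn => forall_pos_of_continuity mono base opn cls,
    fun h A hA _ => ⟨1, one_pos, h (A + 1) (by linarith)⟩⟩

/-- The set of positive reals below a threshold is unbounded iff there is no threshold: with base
and closedness, the property holds everywhere iff it holds at arbitrarily large points. [folklore] -/
theorem forall_iff_unbounded (mono : ∀ {x y : ℝ}, x ≤ y → P y → P x) :
    (∀ A : ℝ, 0 < A → P A) ↔ ∀ B : ℝ, ∃ A : ℝ, B < A ∧ P A := by
  refine ⟨fun h B => ⟨max B 0 + 1, by linarith [le_max_left B 0], h _ (by positivity)⟩,
    fun h A _ => ?_⟩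
  obtain ⟨A', hAA', hP⟩ := h A
  exact mono hAA'.le hP

end Threshold

/-! ## The breaking window of the real-spectrum ladder -/

/-- **If RH fails, the ladder breaks at a sharp, attained window.** Without the Riemann
hypothesis there is `A* > 0` such that, for every `A > 0`, a real family reproducing the Weil
functional on the Weil tests supported in `(-A, A)` exists IFF `A ≤ A*`: BASE (`stub_baseRung`)
makes the rung set non-empty, CLOSED (`stub_closedLadder`) puts its supremum in it, monotonicity
makes it a down-set, and `¬ RH` makes it a proper subset of `(0, ∞)` (every rung ⇒ RH,
`riemannHypothesis_of_forall_rung`). [folklore] -/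
theorem exists_breakingWindow_of_not_riemannHypothesis (h : ¬ _root_.RiemannHypothesis) :
    ∃ Astar : ℝ, 0 < Astar ∧ ∀ A : ℝ, 0 < A →
      ((∃ (ι : Type) (γ : ι → ℝ), ∀ g : ℝ → ℂ, IsWeilTest g → tsupport g ⊆ Set.Ioo (-A) A →
        HasSum (fun i => weilMellin g (1 / 2 + (γ i : ℂ) * I)) (weilFunctional g)) ↔ A ≤ Astar) :=
  Threshold.exists_of_not_forall
    (P := fun A => ∃ (ι : Type) (γ : ι → ℝ), ∀ g : ℝ → ℂ, IsWeilTest g →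
      tsupport g ⊆ Set.Ioo (-A) A →
        HasSum (fun i => weilMellin g (1 / 2 + (γ i : ℂ) * I)) (weilFunctional g))
    (fun hxy hy => rung_mono hxy hy) stub_baseRung stub_closedLadder
    (fun hall => h (riemannHypothesis_of_forall_rung hall))

/-- **A breaking window refutes RH** (under RH every open window carries a rung,
`forall_rung_of_riemannHypothesis`, but the rung at `A* + 1` fails). [folklore] -/
theorem not_riemannHypothesis_of_breakingWindow {Astar : ℝ} (h0 : 0 < Astar)
    (h : ∀ A : ℝ, 0 < A →
      ((∃ (ι : Type) (γ : ι → ℝ), ∀ g : ℝ → ℂ, IsWeilTest g → tsupport g ⊆ Set.Ioo (-A) A →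
        HasSum (fun i => weilMellin g (1 / 2 + (γ i : ℂ) * I)) (weilFunctional g)) ↔ A ≤ Astar)) :
    ¬ _root_.RiemannHypothesis := fun hRH =>
  Threshold.not_forall
    (P := fun A => ∃ (ι : Type) (γ : ι → ℝ), ∀ g : ℝ → ℂ, IsWeilTest g →
      tsupport g ⊆ Set.Ioo (-A) A →
        HasSum (fun i => weilMellin g (1 / 2 + (γ i : ℂ) * I)) (weilFunctional g))
    h0 h (forall_rung_of_riemannHypothesis hRH)

/-- **Registered anchor `stub_breakingWindow` — threshold normal form of the line's residue.**
The Riemann hypothesis FAILS iff the real-spectrum ladder has a breaking window: a positive real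
`A*` such that a real family `γ` with `Σ_i ĝ(1/2 + iγ_i) = W(g)` for all Weil tests `g` supported
in `(-A, A)` exists exactly for the windows `A ≤ A*`. Equivalently (negating both sides) RH holds
iff the closed down-set of rung-carrying windows, non-empty by `stub_baseRung`, is unbounded.
[folklore] -/
theorem stub_breakingWindow :
    ¬ _root_.RiemannHypothesis ↔ ∃ Astar : ℝ, 0 < Astar ∧ ∀ A : ℝ, 0 < A →
      ((∃ (ι : Type) (γ : ι → ℝ), ∀ g : ℝ → ℂ, IsWeilTest g → tsupport g ⊆ Set.Ioo (-A) A →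
        HasSum (fun i => weilMellin g (1 / 2 + (γ i : ℂ) * I)) (weilFunctional g)) ↔ A ≤ Astar) :=
  ⟨exists_breakingWindow_of_not_riemannHypothesis,
    fun ⟨_, h0, h⟩ => not_riemannHypothesis_of_breakingWindow h0 h⟩

/-- **Dichotomy**: either the Riemann hypothesis holds, or the ladder has a (unique, attained)
breaking window `A* > 0`. [folklore] -/
theorem riemannHypothesis_or_exists_breakingWindow :
    _root_.RiemannHypothesis ∨ ∃ Astar : ℝ, 0 < Astar ∧ ∀ A : ℝ, 0 < A →
      ((∃ (ι : Type) (γ : ι → ℝ), ∀ g : ℝ → ℂ, IsWeilTest g → tsupport g ⊆ Set.Ioo (-A) A →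
        HasSum (fun i => weilMellin g (1 / 2 + (γ i : ℂ) * I)) (weilFunctional g)) ↔ A ≤ Astar) := by
  by_cases h : _root_.RiemannHypothesis
  · exact Or.inl h
  · exact Or.inr (exists_breakingWindow_of_not_riemannHypothesis h)

/-- The breaking window, when it exists, is unique. [folklore] -/
theorem breakingWindow_unique {a b : ℝ} (ha : 0 < a) (hb : 0 < b)
    (hPa : ∀ A : ℝ, 0 < A →
      ((∃ (ι : Type) (γ : ι → ℝ), ∀ g : ℝ → ℂ, IsWeilTest g → tsupport g ⊆ Set.Ioo (-A) A →
        HasSum (fun i => weilMellin g (1 / 2 + (γ i : ℂ) * I)) (weilFunctional g)) ↔ A ≤ a))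
    (hPb : ∀ A : ℝ, 0 < A →
      ((∃ (ι : Type) (γ : ι → ℝ), ∀ g : ℝ → ℂ, IsWeilTest g → tsupport g ⊆ Set.Ioo (-A) A →
        HasSum (fun i => weilMellin g (1 / 2 + (γ i : ℂ) * I)) (weilFunctional g)) ↔ A ≤ b)) :
    a = b :=
  Threshold.unique
    (P := fun A => ∃ (ι : Type) (γ : ι → ℝ), ∀ g : ℝ → ℂ, IsWeilTest g →
      tsupport g ⊆ Set.Ioo (-A) A →
        HasSum (fun i => weilMellin g (1 / 2 + (γ i : ℂ) * I)) (weilFunctional g))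
    ha hb hPa hPb

/-- A breaking window kills the openness stub of the line directly (the rung at `A*` holds and
extends to no `A* + ε`) — the order-theoretic shadow of `openLadder_iff_riemannHypothesis`.
[folklore] -/
theorem not_openLadder_of_breakingWindow {Astar : ℝ} (h0 : 0 < Astar)
    (h : ∀ A : ℝ, 0 < A →
      ((∃ (ι : Type) (γ : ι → ℝ), ∀ g : ℝ → ℂ, IsWeilTest g → tsupport g ⊆ Set.Ioo (-A) A →
        HasSum (fun i => weilMellin g (1 / 2 + (γ i : ℂ) * I)) (weilFunctional g)) ↔ A ≤ Astar)) :
    ¬ ∀ A : ℝ, 0 < A →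
      (∃ (ι : Type) (γ : ι → ℝ), ∀ g : ℝ → ℂ, IsWeilTest g → tsupport g ⊆ Set.Ioo (-A) A →
        HasSum (fun i => weilMellin g (1 / 2 + (γ i : ℂ) * I)) (weilFunctional g)) →
      ∃ ε : ℝ, 0 < ε ∧ ∃ (ι : Type) (γ : ι → ℝ), ∀ g : ℝ → ℂ, IsWeilTest g →
        tsupport g ⊆ Set.Ioo (-(A + ε)) (A + ε) →
          HasSum (fun i => weilMellin g (1 / 2 + (γ i : ℂ) * I)) (weilFunctional g) :=
  Threshold.not_open
    (P := fun A => ∃ (ι : Type) (γ : ι → ℝ), ∀ g : ℝ → ℂ, IsWeilTest g →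
      tsupport g ⊆ Set.Ioo (-A) A →
        HasSum (fun i => weilMellin g (1 / 2 + (γ i : ℂ) * I)) (weilFunctional g))
    h0 h

/-- **`X ↔` rungs on arbitrarily large windows** (the rung set is a down-set, so unbounded means
everything, and everything is `X` by `spectralThesis_iff_forall_rung`). [folklore] -/
theorem spectralThesis_iff_rungs_unbounded :
    SpectralThesis ↔ ∀ B : ℝ, ∃ A : ℝ, B < A ∧
      ∃ (ι : Type) (γ : ι → ℝ), ∀ g : ℝ → ℂ, IsWeilTest g → tsupport g ⊆ Set.Ioo (-A) A →
        HasSum (fun i => weilMellin g (1 / 2 + (γ i : ℂ) * I)) (weilFunctional g) :=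
  spectralThesis_iff_forall_rung.trans
    (Threshold.forall_iff_unbounded
      (P := fun A => ∃ (ι : Type) (γ : ι → ℝ), ∀ g : ℝ → ℂ, IsWeilTest g →
        tsupport g ⊆ Set.Ioo (-A) A →
          HasSum (fun i => weilMellin g (1 / 2 + (γ i : ℂ) * I)) (weilFunctional g))
      (fun hxy hy => rung_mono hxy hy))

/-! ## The positivity side of the breaking window -/

/-- **Below half the breaking window, Weil positivity holds.** If `A*` is the breaking window
and `2a < A*`, then `W(g ⋆ g̃) ≥ 0` for every Weil test `g` supported in `[-a, a]`: the open
rung at `A = max (a + A*/2) (A*/2) ≤ A*` contains the closed window `[-2a, 2a]`, and a window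
trace is a sum of `|ĝ(1/2 + iγ_i)|² ≥ 0` on such tests (`weilPositivityOn_of_windowTrace`).
[Bombieri2000Weil, Thm. 1 (easy half, on a window)] -/
theorem weilPositivityOn_of_two_mul_lt_breakingWindow {Astar : ℝ} (h0 : 0 < Astar)
    (h : ∀ A : ℝ, 0 < A →
      ((∃ (ι : Type) (γ : ι → ℝ), ∀ g : ℝ → ℂ, IsWeilTest g → tsupport g ⊆ Set.Ioo (-A) A →
        HasSum (fun i => weilMellin g (1 / 2 + (γ i : ℂ) * I)) (weilFunctional g)) ↔ A ≤ Astar))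
    {a : ℝ} (ha : 2 * a < Astar) : WeilPositivityOn a := by
  set A : ℝ := max (a + Astar / 2) (Astar / 2) with hA_def
  have hApos : 0 < A := lt_of_lt_of_le (by positivity) (le_max_right _ _)
  have hAle : A ≤ Astar := max_le (by linarith) (by linarith)
  have h2aA : 2 * a < A := lt_of_lt_of_le (by linarith) (le_max_left _ _)
  obtain ⟨ι, γ, hγ⟩ := (h A hApos).2 hAle
  have hγ' : ∀ g : ℝ → ℂ, IsWeilTest g → tsupport g ⊆ Icc (-(2 * a)) (2 * a) →
      HasSum (fun i => weilMellin g (1 / 2 + (γ i : ℂ) * I)) (weilFunctional g) :=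
    fun g hg hgs => hγ g hg (hgs.trans (Icc_subset_Ioo (by linarith) h2aA))
  exact weilPositivityOn_of_windowTrace hγ'

/-- **A Weil-negative test bounds the breaking window**: if Weil positivity fails on `[-a, a]`,
then `A* ≤ 2a` (contrapositive of `weilPositivityOn_of_two_mul_lt_breakingWindow`). This is the
inequality the Davenport–Heilbronn calibration of the line measures (there the truncated Weil form
is certifiably negative from half-width `2.5`). [Bombieri2000Weil, Thm. 1 (easy half, on a window)] -/
theorem breakingWindow_le_two_mul_of_not_weilPositivityOn {Astar : ℝ} (h0 : 0 < Astar)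
    (h : ∀ A : ℝ, 0 < A →
      ((∃ (ι : Type) (γ : ι → ℝ), ∀ g : ℝ → ℂ, IsWeilTest g → tsupport g ⊆ Set.Ioo (-A) A →
        HasSum (fun i => weilMellin g (1 / 2 + (γ i : ℂ) * I)) (weilFunctional g)) ↔ A ≤ Astar))
    {a : ℝ} (hna : ¬ WeilPositivityOn a) : Astar ≤ 2 * a := by
  by_contra hlt
  push Not at hlt
  exact hna (weilPositivityOn_of_two_mul_lt_breakingWindow h0 h hlt)

/-- **A breaking window comes with a Weil-negative test beyond it.** If `A*` is the breaking
window then RH fails, so by Yoshida's form of Weil's criterion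
(`riemannHypothesis_iff_forall_weilPositivityOn`) Weil positivity fails on some `[-a, a]`, and any
such `a` has `A* ≤ 2a`; by Yoshida's theorem (`weilPositivityOn_of_le_log_two_half`) also
`log 2 / 2 < a`. [Bombieri2000Weil, Thm. 2; Yoshida1992, Thm. 1] -/
theorem exists_not_weilPositivityOn_of_breakingWindow {Astar : ℝ} (h0 : 0 < Astar)
    (h : ∀ A : ℝ, 0 < A →
      ((∃ (ι : Type) (γ : ι → ℝ), ∀ g : ℝ → ℂ, IsWeilTest g → tsupport g ⊆ Set.Ioo (-A) A →
        HasSum (fun i => weilMellin g (1 / 2 + (γ i : ℂ) * I)) (weilFunctional g)) ↔ A ≤ Astar)) :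
    ∃ a : ℝ, Real.log 2 / 2 < a ∧ Astar ≤ 2 * a ∧ ¬ WeilPositivityOn a := by
  have hnRH : ¬ _root_.RiemannHypothesis := not_riemannHypothesis_of_breakingWindow h0 h
  rw [riemannHypothesis_iff_forall_weilPositivityOn] at hnRH
  push Not at hnRH
  obtain ⟨a, _, hna⟩ := hnRH
  refine ⟨a, ?_, breakingWindow_le_two_mul_of_not_weilPositivityOn h0 h hna, hna⟩
  by_contra hle
  push Not at hle
  exact hna (weilPositivityOn_of_le_log_two_half hle)

/-! ## The breaking window in the route's closed-window language (`tsupport g ⊆ Icc (-A) A`) -/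

/-- **Closed-window rungs hold strictly below the breaking window**: for `A < A*` the route's
rung `Trace(A)` (tests supported in `[-A, A]`) holds — restrict the open rung at `A*`. [folklore] -/
theorem Icc_rung_of_lt_breakingWindow {Astar : ℝ} (h0 : 0 < Astar)
    (h : ∀ A : ℝ, 0 < A →
      ((∃ (ι : Type) (γ : ι → ℝ), ∀ g : ℝ → ℂ, IsWeilTest g → tsupport g ⊆ Set.Ioo (-A) A →
        HasSum (fun i => weilMellin g (1 / 2 + (γ i : ℂ) * I)) (weilFunctional g)) ↔ A ≤ Astar))
    {A : ℝ} (hA : A < Astar) :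
    ∃ (ι : Type) (γ : ι → ℝ), ∀ g : ℝ → ℂ, IsWeilTest g → tsupport g ⊆ Set.Icc (-A) A →
      HasSum (fun i => weilMellin g (1 / 2 + (γ i : ℂ) * I)) (weilFunctional g) := by
  obtain ⟨ι, γ, hγ⟩ := (h Astar h0).2 le_rfl
  exact ⟨ι, γ, fun g hg hgs => hγ g hg (hgs.trans (Icc_subset_Ioo (by linarith) hA))⟩

/-- **Closed-window rungs fail strictly above the breaking window**: for `A > A*` no real family
reproduces `W` on the Weil tests supported in `[-A, A]` (such a family would be an open rung at
`A`, forcing `A ≤ A*`). Only the endpoint `A = A*` is left undecided by the threshold. [folklore] -/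
theorem not_Icc_rung_of_breakingWindow_lt {Astar : ℝ} (h0 : 0 < Astar)
    (h : ∀ A : ℝ, 0 < A →
      ((∃ (ι : Type) (γ : ι → ℝ), ∀ g : ℝ → ℂ, IsWeilTest g → tsupport g ⊆ Set.Ioo (-A) A →
        HasSum (fun i => weilMellin g (1 / 2 + (γ i : ℂ) * I)) (weilFunctional g)) ↔ A ≤ Astar))
    {A : ℝ} (hA : Astar < A) :
    ¬ ∃ (ι : Type) (γ : ι → ℝ), ∀ g : ℝ → ℂ, IsWeilTest g → tsupport g ⊆ Set.Icc (-A) A →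
      HasSum (fun i => weilMellin g (1 / 2 + (γ i : ℂ) * I)) (weilFunctional g) := by
  rintro ⟨ι, γ, hγ⟩
  have hle : A ≤ Astar :=
    (h A (h0.trans hA)).1 ⟨ι, γ, fun g hg hgs => hγ g hg (hgs.trans Ioo_subset_Icc_self)⟩
  linarith

/-- **The seed item pins the breaking window above `log 2`**: if the route's `WindowTraceArch`
(stmt-RiemannHypothesis-11195, the closed window `[-log 2, log 2]`) holds and the ladder breaks at
`A*`, then `log 2 ≤ A*`. More generally every proved closed-window rung `Trace(A)` gives `A ≤ A*`
(`not_Icc_rung_of_breakingWindow_lt`). [folklore] -/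
theorem log_two_le_breakingWindow_of_windowTraceArch {Astar : ℝ} (h0 : 0 < Astar)
    (h : ∀ A : ℝ, 0 < A →
      ((∃ (ι : Type) (γ : ι → ℝ), ∀ g : ℝ → ℂ, IsWeilTest g → tsupport g ⊆ Set.Ioo (-A) A →
        HasSum (fun i => weilMellin g (1 / 2 + (γ i : ℂ) * I)) (weilFunctional g)) ↔ A ≤ Astar))
    (hArch : WindowTraceArch) : Real.log 2 ≤ Astar := by
  by_contra hlt
  push Not at hlt
  exact not_Icc_rung_of_breakingWindow_lt h0 h hlt hArch

/-- **Under the seed, a failure of RH is a failure of the STEP at one integer rung.** If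
`WindowTraceArch` holds and RH fails, there is `n ≥ 2` with a closed-window rung at `log n` and
NONE at `log (n + 1)` — the contrapositive of the route's `closes`, located: `n = ⌊e^{A*}⌋` or
`⌊e^{A*}⌋ - 1` for the breaking window `A*`. (Proof here by the least failing integer rung, which
exists because every rung would give RH, `riemannHypothesis_of_ladder`.) [folklore] -/
theorem exists_failing_step_of_windowTraceArch_of_not_riemannHypothesis (hArch : WindowTraceArch)
    (hnRH : ¬ _root_.RiemannHypothesis) :
    ∃ n : ℕ, 2 ≤ n ∧
      (∃ (ι : Type) (γ : ι → ℝ), ∀ g : ℝ → ℂ, IsWeilTest g →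
        tsupport g ⊆ Set.Icc (-Real.log (n : ℝ)) (Real.log (n : ℝ)) →
          HasSum (fun i => weilMellin g (1 / 2 + (γ i : ℂ) * I)) (weilFunctional g)) ∧
      ¬ ∃ (ι : Type) (γ : ι → ℝ), ∀ g : ℝ → ℂ, IsWeilTest g →
        tsupport g ⊆ Set.Icc (-Real.log ((n : ℝ) + 1)) (Real.log ((n : ℝ) + 1)) →
          HasSum (fun i => weilMellin g (1 / 2 + (γ i : ℂ) * I)) (weilFunctional g) := by
  classical
  have hnot : ∃ n : ℕ, 2 ≤ n ∧ ¬ ∃ (ι : Type) (γ : ι → ℝ), ∀ g : ℝ → ℂ, IsWeilTest g →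
      tsupport g ⊆ Set.Icc (-Real.log (n : ℝ)) (Real.log (n : ℝ)) →
        HasSum (fun i => weilMellin g (1 / 2 + (γ i : ℂ) * I)) (weilFunctional g) := by
    by_contra hall
    refine hnRH (riemannHypothesis_of_ladder fun A hA => ?_)
    obtain ⟨n, hn⟩ := exists_nat_ge (Real.exp A)
    have hrung : ∃ (ι : Type) (γ : ι → ℝ), ∀ g : ℝ → ℂ, IsWeilTest g →
        tsupport g ⊆ Set.Icc (-Real.log ((max n 2 : ℕ) : ℝ)) (Real.log ((max n 2 : ℕ) : ℝ)) →
          HasSum (fun i => weilMellin g (1 / 2 + (γ i : ℂ) * I)) (weilFunctional g) := by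
      by_contra hfail
      exact hall ⟨max n 2, le_max_right n 2, hfail⟩
    obtain ⟨ι, γ, hγ⟩ := hrung
    have hpos : (0 : ℝ) < ((max n 2 : ℕ) : ℝ) := by positivity
    have hAn : A ≤ Real.log ((max n 2 : ℕ) : ℝ) := by
      rw [Real.le_log_iff_exp_le hpos]
      exact hn.trans (by exact_mod_cast le_max_left n 2)
    exact ⟨ι, γ, fun g hg hsupp => hγ g hg (hsupp.trans (Icc_subset_Icc (neg_le_neg hAn) hAn))⟩
  let m := Nat.find hnot
  have hm : 2 ≤ m ∧ ¬ ∃ (ι : Type) (γ : ι → ℝ), ∀ g : ℝ → ℂ, IsWeilTest g →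
      tsupport g ⊆ Set.Icc (-Real.log (m : ℝ)) (Real.log (m : ℝ)) →
        HasSum (fun i => weilMellin g (1 / 2 + (γ i : ℂ) * I)) (weilFunctional g) := Nat.find_spec hnot
  have hm2 : m ≠ 2 := by
    intro h2
    apply hm.2
    rw [h2]
    push_cast
    exact hArch
  have hm3 : 3 ≤ m := by
    rcases hm.1.lt_or_eq with hlt | heq
    · exact hlt
    · exact absurd heq.symm hm2
  refine ⟨m - 1, by omega, ?_, ?_⟩
  · by_contra hfail
    have hmin := Nat.find_min hnot (show m - 1 < m by omega)
    exact hmin ⟨by omega, hfail⟩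
  · have hcast : ((m - 1 : ℕ) : ℝ) + 1 = (m : ℝ) := by
      rw [Nat.cast_sub (by omega : 1 ≤ m)]
      push_cast
      ring
    rw [hcast]
    exact hm.2

end Summit.RiemannHypothesis.RiemannHypothesis.Theorems.SpectralThesis.Sketch

end
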